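import Summits.BirchSwinnertonDyer.BirchSwinnertonDyer.Theorems.SignedLowerHalvesSmallImageLowerHalfBothSignsLambdaLowerThreeNsThetaPartnerUnitValues
import Summits.BirchSwinnertonDyer.BirchSwinnertonDyer.Theorems.ResidualThetaTransportAtTwoHeckeThetaPartnerAdicAtTwoTeichmullerTwist
import Summits.BirchSwinnertonDyer.BirchSwinnertonDyer.Theorems.ResidualThetaTransportAtTwoHeckeThetaPartnerAdicAtTwoTypeOneGrossencharakter
import Summits.BirchSwinnertonDyer.BirchSwinnertonDyer.Theorems.ResidualThetaTransportAtTwoHeckeThetaPartnerAdicAtTwoUnitCharacter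
import Literature.NumberTheory.GaloisRepresentations.HeckeCharacterDictionary
import HarnessLib

/-!
# The type-`(1,0)` Teichmüller twist of the Hecke character of the dihedral constituent (brick R3)

Route `SignedLowerHalves`, child L `SmallImageLowerHalfBothSigns` (item stmt-BirchSwinnertonDyer-23599), line
proposal `rtt_w3`, stub K0₂@p `stub_heckeThetaPartner_ns` — brick R3 ("twist") of the arithmetic half at an ODD
prime (width seat `bsd-line-slh-p3-w3` gen 9; memo `Lines/birth_acns-MEMO-w3-g9.md`).  THEOREMS ONLY (no
definition, no named fact, no `sorry`); ROUTE-INDEPENDENT.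

Assembly of the GENERIC half of the `p = 2` arithmetic-half files at an arbitrary prime `p` INERT in an imaginary
quadratic field `K`: the unit character `λ mod (t)` (`HeckeThetaPartner.exists_unitCharacter`), the type-`(1,0)`
Größencharakter `ψ₀ mod (t)` with `ψ̃₀((b)) = σ(b)λ(b̄)` (`…exists_isGrossencharakter_embType`), its `p`-adic unit
values (brick R3a `norm_symm_eq_one_of_principal_values'`), and the Teichmüller twist
(`…exists_isGrossencharakter_congr`) against the prime-value function `𝔮 ↦ η(ϖ_𝔮)` of a FINITE-ORDER Hecke
character `η` whose MATCHING CONDITION at `(p)` is supplied (brick S7 `norm_idealPow_sub_embedding_lt_one`):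

* `isCoprime_span_intCast_span_natCast` — `(t)` and `(p)` are coprime in `𝓞 K` when `p ∤ t` and `(p)` is maximal;
* **`exists_grossencharakter_twist`** — there are `λ`, `ψ₀` and a Größencharakter `ψ mod (t)` of type `σ` with
  `ψ(𝔮) ≡ η(ϖ_𝔮)` (`e`-adically) at every prime `𝔮 ∤ p·t`, `ψ̃((b)) = ψ̃₀((b))·u_b` (`u_b` a root of unity of
  order prime to `p`, congruent to `η̃((b))/ψ̃₀((b))`) for `b` prime to `p·t`, and `ψ̃₀((n)) = n·(d_K/n)` on
  integers prime to `t`.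

BSD, crux L and the stub are NOT proved here.

References: J. Neukirch, ANT VII §6; K. Ribet, LNM 601 (1977) §3; J.-P. Serre, *Local Fields* II §4 Prop. 8.
-/

set_option autoImplicit false
set_option linter.dupNamespace false

noncomputable section

open scoped NumberField nonZeroDivisors
open NumberField IsDedekindDomain
open Literature.NumberTheory.LFunctions Literature.NumberTheory.GaloisRepresentations

namespace Summit.BirchSwinnertonDyer.BirchSwinnertonDyer.Theorems.SmallImageLambdaLowerThreeNsThetaPartner

open Summit.BirchSwinnertonDyer.BirchSwinnertonDyer.Theorems.HeckeThetaPartner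
  Literature.NumberTheory.GaloisRepresentations.HeckeCharacter Literature.NumberTheory.QuadraticFields.Quadratic

variable {K : Type} [Field K] [NumberField K] {p : ℕ} [Fact p.Prime]

/-- `(b)` and `(p)` are coprime ideals of `𝓞 K` when `(p)` is prime (hence maximal) and `b ∉ (p)`. [folklore] -/
theorem isCoprime_span_of_not_mem (hp : (Ideal.span {(p : 𝓞 K)}).IsPrime) {b : 𝓞 K}
    (hb : b ∉ Ideal.span {(p : 𝓞 K)}) :
    IsCoprime (Ideal.span {b}) (Ideal.span {(p : 𝓞 K)}) := by
  have hp0 : Ideal.span {(p : 𝓞 K)} ≠ ⊥ := by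
    rw [Ne, Ideal.span_singleton_eq_bot]; exact_mod_cast (Fact.out : p.Prime).ne_zero
  have hPmax : (Ideal.span {(p : 𝓞 K)}).IsMaximal := hp.isMaximal hp0
  refine (isCoprime_iff_forall_not_le hp0).mpr fun v hv hbv => hb ?_
  have : v.asIdeal = Ideal.span {(p : 𝓞 K)} := (hPmax.eq_of_le v.isPrime.ne_top hv).symm
  exact this ▸ hbv (Ideal.mem_span_singleton_self b)

/-- Values of a FINITE-ORDER Hecke character at uniformisers are roots of unity, hence `e`-adic units. [folklore] -/
theorem norm_symm_valueAtUniformizer_eq_one (e : PadicAlgCl p ≃+* ℂ) {η : HeckeCharacter K}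
    (hfin : η.IsFiniteOrder) (w : HeightOneSpectrum (𝓞 K)) : ‖e.symm (η.valueAtUniformizer w)‖ = 1 := by
  refine norm_symm_eq_one_of_pow_eq_one e hfin.orderOf_pos ?_
  rw [valueAtUniformizer, localComponent_apply, ← Units.val_pow_eq_pow_val, ← pow_apply, pow_orderOf_eq_one,
    one_apply, Units.val_one]

/-- **The Teichmüller twist of type `(1,0)` against a finite-order Hecke character** (brick R3).  `K` imaginary
quadratic (`[K:ℚ] = 2`, totally complex, `δ² = Δ < 0` in `𝓞 K`), `(p)` prime in `𝓞 K`, `e : ℚ̄_p ≃ ℂ`, `σ : K → ℂ`,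
`η` a finite-order Hecke character, `t ∈ ℤ` with `|t| ≥ 3`, `d_K ∣ t`, `p ∤ t`, and the MATCHING CONDITION for `σ`:
`‖e⁻¹η̃((b)) − e⁻¹σ(b)‖ < 1` for every `b ≠ 0`, `b ∉ (p)`, `b ≡ 1 mod t`.  Then there are the unit character
`λ mod (t)` (with `λ(n̄) = (d_K/n)`), the type-`(1,0)` Größencharakter `ψ₀ mod (t)` (`ψ̃₀((b)) = σ(b)λ(b̄)`), and a
Größencharakter `ψ mod (t)` of type `σ` with `ψ(𝔮) ≡ η(ϖ_𝔮)` at `𝔮 ∤ p t` and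
`ψ̃((b)) = ψ̃₀((b))·u_b`, `u_b` a root of unity of order prime to `p`, `u_b ψ̃₀((b)) ≡ η̃((b))`, for `b` prime to `p t`.
[cite: NeukirchANT1999, Ch. VII §6 Def. (6.1) and Cor. (6.14)] [cite: SerreLocalFields1979, Ch. II §4 Prop. 8] -/
theorem exists_grossencharakter_twist [IsTotallyComplex K] (hK2 : Module.finrank ℚ K = 2)
    (hp : (Ideal.span {(p : 𝓞 K)}).IsPrime) {δ : 𝓞 K} {Δ : ℤ} (hΔ : Δ < 0) (hδ : (δ : K) ^ 2 = (Δ : K))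
    (e : PadicAlgCl p ≃+* ℂ) (σ : K →+* ℂ) {η : HeckeCharacter K} (hfin : η.IsFiniteOrder)
    {t : ℤ} (ht3 : 3 ≤ |t|) (hdt : discr K ∣ t) (hpt : (t : 𝓞 K) ∉ Ideal.span {(p : 𝓞 K)})
    (hM : ∀ b : 𝓞 K, b ≠ 0 → b ∉ Ideal.span {(p : 𝓞 K)} → b - 1 ∈ Ideal.span {(t : 𝓞 K)} →
      ‖e.symm (idealPow K (fun w => η.valueAtUniformizer w) (Ideal.span {b})) - e.symm (σ (b : K))‖ < 1) :
    ∃ (lam : (𝓞 K ⧸ Ideal.span {(t : 𝓞 K)})ˣ →* ℂˣ) (ψ₀ ψ : HeightOneSpectrum (𝓞 K) → ℂ),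
      (∀ (n : ℤ) (hn : IsUnit (Ideal.Quotient.mk (Ideal.span {(t : 𝓞 K)}) (n : 𝓞 K))),
        ∃ hu : IsUnit (n : ZMod (discr K).natAbs),
          (lam hn.unit : ℂ) = ((discrChar (discr K) hu.unit : ℤˣ) : ℤ)) ∧
      (∀ (b : 𝓞 K), b ≠ 0 → ∀ hb : IsUnit (Ideal.Quotient.mk (Ideal.span {(t : 𝓞 K)}) b),
        idealPow K ψ₀ (Ideal.span {b}) = σ (b : K) * (lam hb.unit : ℂ)) ∧
      IsGrossencharakter (Ideal.span {(t : 𝓞 K)}) (embType σ) (embTypeConj σ) ψ ∧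
      (∀ w : HeightOneSpectrum (𝓞 K), ¬ Ideal.span {(p : 𝓞 K)} ≤ w.asIdeal →
        ¬ Ideal.span {(t : 𝓞 K)} ≤ w.asIdeal → ‖e.symm (ψ w) - e.symm (η.valueAtUniformizer w)‖ < 1) ∧
      (∀ b : 𝓞 K, b ≠ 0 → b ∉ Ideal.span {(p : 𝓞 K)} → IsCoprime (Ideal.span {b}) (Ideal.span {(t : 𝓞 K)}) →
        ∃ u : ℂ, (∃ n : ℕ, 0 < n ∧ ¬ p ∣ n ∧ u ^ n = 1) ∧
          idealPow K ψ (Ideal.span {b}) = idealPow K ψ₀ (Ideal.span {b}) * u ∧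
          ‖e.symm u * e.symm (idealPow K ψ₀ (Ideal.span {b})) -
            e.symm (idealPow K (fun w => η.valueAtUniformizer w) (Ideal.span {b}))‖ < 1) := by
  classical
  set 𝔪 : Ideal (𝓞 K) := Ideal.span {(t : 𝓞 K)} with h𝔪
  have ht0 : t ≠ 0 := by intro h; rw [h] at ht3; norm_num at ht3
  have h𝔪0 : 𝔪 ≠ ⊥ := by
    rw [h𝔪, Ne, Ideal.span_singleton_eq_bot]; exact_mod_cast ht0
  have hp0 : Ideal.span {(p : 𝓞 K)} ≠ ⊥ := by
    rw [Ne, Ideal.span_singleton_eq_bot]; exact_mod_cast (Fact.out : p.Prime).ne_zero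
  -- the unit character and the type-`(1,0)` Größencharakter
  obtain ⟨lam, hlamU, hlamZ⟩ := exists_unitCharacter hK2 σ hΔ hδ ht3 hdt
  obtain ⟨ψ₀, hψ₀G, hψ₀val⟩ := exists_isGrossencharakter_embType σ lam hlamU
  -- coprimality `(t) + (p) = 1`
  have h𝔪p : IsCoprime 𝔪 (Ideal.span {(p : 𝓞 K)}) := isCoprime_span_of_not_mem hp hpt
  -- the unit hypothesis
  have hU : ∀ w : HeightOneSpectrum (𝓞 K), ¬ Ideal.span {(p : 𝓞 K)} ≤ w.asIdeal → ¬ 𝔪 ≤ w.asIdeal →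
      ‖e.symm (η.valueAtUniformizer w)‖ = 1 ∧ ‖e.symm (ψ₀ w)‖ = 1 := by
    intro w hwp hw𝔪
    refine ⟨norm_symm_valueAtUniformizer_eq_one e hfin w, ?_⟩
    have hwp' : w.asIdeal ≠ Ideal.span {(p : 𝓞 K)} := fun h => hwp (le_of_eq h.symm)
    exact norm_symm_eq_one_of_principal_values' e σ hp h𝔪0 lam hψ₀val w hwp' hw𝔪
  -- the matching hypothesis in the Teichmüller-twist form
  have hM' : ∀ b : 𝓞 K, b ≠ 0 → b ∉ Ideal.span {(p : 𝓞 K)} → b - 1 ∈ 𝔪 →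
      ‖e.symm (idealPow K (fun w => η.valueAtUniformizer w) (Ideal.span {b})) -
        e.symm (idealPow K ψ₀ (Ideal.span {b}))‖ < 1 := by
    intro b hb0 hbp hb1
    have hunit : IsUnit (Ideal.Quotient.mk 𝔪 b) := by
      have : Ideal.Quotient.mk 𝔪 b = 1 := by
        rw [← map_one (Ideal.Quotient.mk 𝔪), Ideal.Quotient.eq]; exact hb1
      rw [this]; exact isUnit_one
    have hone : hunit.unit = 1 := by
      apply Units.ext
      rw [IsUnit.unit_spec, Units.val_one, ← map_one (Ideal.Quotient.mk 𝔪), Ideal.Quotient.eq]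
      exact hb1
    rw [hψ₀val b hb0 hunit, hone, map_one, Units.val_one, mul_one]
    exact hM b hb0 hbp hb1
  obtain ⟨ψ, hψG, hψcong, hψval⟩ := exists_isGrossencharakter_congr e hp h𝔪0 h𝔪p hψ₀G hU hM'
  exact ⟨lam, ψ₀, ψ, hlamZ, hψ₀val, hψG, hψcong, hψval⟩

end Summit.BirchSwinnertonDyer.BirchSwinnertonDyer.Theorems.SmallImageLambdaLowerThreeNsThetaPartner

end
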